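import Mathlib
import Summits.RiemannHypothesis.RiemannHypothesis.Theorems.HandoffRealZeroCount
import Summits.RiemannHypothesis.RiemannHypothesis.Theorems.HandoffRealZeroCountMult
import Summits.RiemannHypothesis.RiemannHypothesis.Theorems.HandoffXiZeroCount
import Literature.NumberTheory.LFunctions.RiemannXiProofs
import Literature.NumberTheory.LFunctions.ZetaZeros
import Literature.Analysis.Complex.FourierPolyaKiKimEngine
import HarnessLib

/-!
# ROUTE R-K «COUNT-AND-THIN» WITH MULTIPLICITY: the existential criterion is EXACTLY RH

Handoff track (ROUTE 1′), prove-1 gen13; companion of `HandoffCountThin*.lean` (idea-3 gen22 ROUTE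
R-K, TASK H-K1). Built imports + `HandoffRealZeroCountMult` (Rolle with multiplicities).

With the count law stated for DISTINCT real zeros, the existential form of the criterion sits
between `RH ∧ SimpleZerosConjecture` and `RH` (`HandoffCountThin`/`…Statements`): a multiple real
zero of `Ξ` can be matched by distinct zeros of approximants only after splitting it. Counting WITH
MULTIPLICITY removes the gap. A multiplicity datum for `F_t` on `(0, T]` is a finite set `S ⊆ (0, T]`
with weights `m x ≥ 1` such that `F_t^{(i)}(x) = 0` for `i < m x`; the count law with multiplicity
asks (eventually in `t`) for a datum of total weight `≥ N(T)`.

* `im_eq_zero_of_multCountGe_of_smoothConvergence` — one window, real `C^{N(T)}` approximants: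
  a datum of weight `≥ N(T)` eventually + `C^{N(T)}` convergence on `[0, T]` ⟹ every zero of `Ξ`
  with `0 < Re z ≤ T` is real (the weighted count is upper semicontinuous:
  `RealZeroCount.eventually_sum_mult_zeros_le`);
* `im_eq_zero_of_multCountGe_of_nhds`, `riemannHypothesis_of_frequently_multCountGe_of_nhds` —
  entire families, convergence near `[0, T]` (no realness / normalisation needed: the datum passes to
  `x ↦ Re G_t(x)`);
* `multCount_xi` — under RH the constant family `Ξ` carries, for every `T`, the datum «real zeros in
  `(0, T]` weighted by their orders», of weight exactly `N(T)`;
* `riemannHypothesis_iff_exists_multCount_nhds` — **RH ⟺ there is a family of entire functions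
  converging to `Ξ` near every `[0, T]` and satisfying the count law with multiplicity at every
  `T > 0`.** `riemannHypothesis_iff_exists_multCount_thinRect` — the same with uniform convergence on
  the symmetric thin rectangles `[-T, T] × [-δ, δ]` (one `δ > 0`, all `T`).

A pure equivalence between RH and a statement about the existence of approximants; nothing here is,
or suggests, a proof of RH.
-/

set_option linter.dupNamespace false  -- the mandated namespace repeats `RiemannHypothesis`

noncomputable section

open Filter Set Topology Metric Complex
open scoped BigOperators
open Literature.NumberTheory.LFunctions Literature.Analysis.Complex.KiKim

namespace Summit.RiemannHypothesis.RiemannHypothesis.Theorems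

namespace CountThin

open RealZeroCount

/-- **One window, count with multiplicity, real-axis form.** Let `g_t : ℝ → ℝ` be eventually
`C^{N(T)}`, with eventually a multiplicity datum on `(0, T]` of weight `≥ N(T)`, and
`g_t^{(k)} → (x ↦ Ξ(x))^{(k)}` uniformly on `[0, T]` for `k ≤ N(T)`. Then every zero of `Ξ` with
`0 < Re z ≤ T` is real. -/
theorem im_eq_zero_of_multCountGe_of_smoothConvergence {g : ℝ → ℝ → ℝ} {T : ℝ}
    (hsmooth : ∀ᶠ t : ℝ in atTop, ContDiff ℝ (zetaZeroCount T : ℕ) (g t))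
    (hC : ∀ᶠ t : ℝ in atTop, ∃ (S : Finset ℝ) (m : ℝ → ℕ), (∀ x ∈ S, 0 < x ∧ x ≤ T) ∧
      (∀ x ∈ S, 1 ≤ m x) ∧ (∀ x ∈ S, ∀ i < m x, iteratedDeriv i (g t) x = 0) ∧
        zetaZeroCount T ≤ ∑ x ∈ S, m x)
    (hconv : ∀ k : ℕ, k ≤ zetaZeroCount T →
      TendstoUniformlyOn (fun t => iteratedDeriv k (g t))
        (iteratedDeriv k fun x : ℝ => (riemannXiUpper x).re) atTop (Icc 0 T)) :
    ∀ z : ℂ, riemannXiUpper z = 0 → 0 < z.re → z.re ≤ T → z.im = 0 := by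
  classical
  set f : ℝ → ℝ := fun x => (riemannXiUpper x).re with hf
  set B := (xiZeros_finite T).toFinset with hB
  set Z : Finset ℝ := (B.filter fun z => z.im = 0).image Complex.re with hZ
  set k : ℝ → ℕ := fun c => analyticOrderNatAt riemannXiUpper (c : ℂ) with hk
  have hΞreal := im_riemannXiUpper_ofReal_holds
  have hΞd := differentiable_riemannXiUpper'
  -- bookkeeping: the box sum is `N(T)`; its real part is `∑_{c ∈ Z} k c`
  have hsplit : ∑ z ∈ B, analyticOrderNatAt riemannXiUpper z
      = ∑ z ∈ B.filter (fun z => z.im = 0), analyticOrderNatAt riemannXiUpper z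
        + ∑ z ∈ B.filter (fun z => ¬ z.im = 0), analyticOrderNatAt riemannXiUpper z :=
    (Finset.sum_filter_add_sum_filter_not B _ _).symm
  have hreal_sum : ∑ c ∈ Z, k c
      = ∑ z ∈ B.filter (fun z => z.im = 0), analyticOrderNatAt riemannXiUpper z := by
    rw [hZ, Finset.sum_image]
    · refine Finset.sum_congr rfl fun z hz => ?_
      have hz0 : z.im = 0 := (Finset.mem_filter.mp hz).2
      simp only [k]
      congr 1
      exact Complex.ext (by simp) (by simp [hz0])
    · intro z hz w hw h
      have hz0 : z.im = 0 := (Finset.mem_filter.mp hz).2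
      have hw0 : w.im = 0 := (Finset.mem_filter.mp hw).2
      exact Complex.ext h (by rw [hz0, hw0])
  have hkN : ∀ c ∈ Z, k c ≤ zetaZeroCount T := by
    intro c hc
    obtain ⟨z, hz, rfl⟩ := Finset.mem_image.mp hc
    have hzB : z ∈ B := (Finset.mem_filter.mp hz).1
    have hz0 : z.im = 0 := (Finset.mem_filter.mp hz).2
    have hzre : ((z.re : ℝ) : ℂ) = z := Complex.ext (by simp) (by simp [hz0])
    rw [← sum_analyticOrderNatAt_eq_zetaZeroCount T, ← hB]
    simp only [k, hzre]
    exact Finset.single_le_sum (fun w _ => Nat.zero_le _) hzB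
  have hgzero : ∀ x ∈ Icc (0 : ℝ) T, f x = 0 → x ∈ Z := by
    intro x hx hfx
    have hΞx : riemannXiUpper x = 0 := Complex.ext (by simpa [f] using hfx) (by simpa using hΞreal x)
    have hx0 : 0 < x := by
      rcases hx.1.eq_or_lt with h | h
      · exact absurd (show (x : ℂ).re = 0 by simp [← h]) (re_ne_zero_of_riemannXiUpper_eq_zero hΞx)
      · exact h
    refine Finset.mem_image.mpr ⟨(x : ℂ), Finset.mem_filter.mpr ⟨?_, by simp⟩, by simp⟩
    exact (Set.Finite.mem_toFinset _).mpr ⟨hΞx, by simpa using hx0, by simpa using hx.2⟩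
  -- upper semicontinuity of the weighted real zero count
  have hev := eventually_sum_mult_zeros_le (l := atTop) (G := g) (a := 0) (b := T) (Z := Z) (k := k)
    (N := zetaZeroCount T) (contDiff_re_ofReal (n := 0) hΞd).continuous hgzero ?_ ?_ hkN hsmooth
    (by simpa using hconv 0 (Nat.zero_le _)) ?_
  rotate_left
  · intro c _
    exact ((contDiff_re_ofReal (n := ⊤) hΞd).continuous_iteratedDeriv
      (k c) (by exact_mod_cast le_top)).continuousAt
  · intro c _
    rw [iteratedDeriv_re_ofReal hΞd]
    have him := im_iteratedDeriv_ofReal_eq_zero hΞd hΞreal (k c) c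
    exact fun h => iteratedDeriv_analyticOrderNatAt_ne_zero (c : ℂ)
      (Complex.ext (by simpa using h) (by simpa using him))
  · intro c hc
    exact hconv (k c) (hkN c hc)
  obtain ⟨t, hle, S, m, hS, h1m, hm, hcount⟩ := (hev.and hC).exists
  have hbound : ∑ z ∈ B, analyticOrderNatAt riemannXiUpper z ≤ ∑ c ∈ Z, k c := by
    rw [hB, sum_analyticOrderNatAt_eq_zetaZeroCount]
    exact hcount.trans (hle S m (fun x hx => ⟨(hS x hx).1.le, (hS x hx).2⟩) h1m hm)
  have hzero_sum : ∑ z ∈ B.filter (fun z => ¬ z.im = 0), analyticOrderNatAt riemannXiUpper z = 0 := by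
    have := hbound; rw [hsplit, ← hreal_sum] at this; omega
  intro z hz hz0 hzT
  by_contra hzim
  have hzB : z ∈ B.filter (fun z => ¬ z.im = 0) :=
    Finset.mem_filter.mpr ⟨(Set.Finite.mem_toFinset _).mpr ⟨hz, hz0, hzT⟩, hzim⟩
  have h1 : 1 ≤ analyticOrderNatAt riemannXiUpper z := one_le_analyticOrderNatAt_of_zero hz
  have := Finset.single_le_sum (fun w _ => Nat.zero_le (analyticOrderNatAt riemannXiUpper w)) hzB
  omega

/-- **One window, count with multiplicity, neighbourhood form.** `G_t` entire, `G_t → Ξ` locally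
uniformly on an open `U ⊇ [0, T]`, and eventually a multiplicity datum of `G_t` on `(0, T]` (complex
derivatives `G_t^{(i)}(x) = 0`, `i < m x`, at real points) of weight `≥ N(T)`: then every zero of `Ξ`
with `0 < Re z ≤ T` is real. (No realness or normalisation hypothesis is needed: the datum passes to
the real functions `x ↦ Re G_t(x)`, whose weighted zero count is upper semicontinuous.) -/
theorem im_eq_zero_of_multCountGe_of_nhds {G : ℝ → ℂ → ℂ} (hdiff : ∀ t, Differentiable ℂ (G t))
    {T : ℝ} {U : Set ℂ} (hUo : IsOpen U) (hseg : ∀ x ∈ Icc (0 : ℝ) T, (x : ℂ) ∈ U)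
    (hC : ∀ᶠ t : ℝ in atTop, ∃ (S : Finset ℝ) (m : ℝ → ℕ), (∀ x ∈ S, 0 < x ∧ x ≤ T) ∧
      (∀ x ∈ S, 1 ≤ m x) ∧ (∀ x ∈ S, ∀ i < m x, iteratedDeriv i (G t) (x : ℂ) = 0) ∧
        zetaZeroCount T ≤ ∑ x ∈ S, m x)
    (hloc : TendstoLocallyUniformlyOn G riemannXiUpper atTop U) :
    ∀ z : ℂ, riemannXiUpper z = 0 → 0 < z.re → z.re ≤ T → z.im = 0 := by
  set g : ℝ → ℝ → ℝ := fun t x => (G t x).re with hg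
  refine im_eq_zero_of_multCountGe_of_smoothConvergence (g := g)
    (Eventually.of_forall fun t => contDiff_re_ofReal (hdiff t)) ?_ ?_
  · filter_upwards [hC] with t ⟨S, m, hS, h1m, hm, hsum⟩
    refine ⟨S, m, hS, h1m, fun x hx i hi => ?_, hsum⟩
    change iteratedDeriv i (fun y : ℝ => (G t y).re) x = 0
    rw [iteratedDeriv_re_ofReal (hdiff t)]
    change (iteratedDeriv i (G t) (x : ℂ)).re = 0
    rw [hm x hx i hi, Complex.zero_re]
  · intro k _
    have := tendstoUniformlyOn_re_iteratedDeriv hUo hdiff hloc hseg k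
    rw [iteratedDeriv_re_ofReal differentiable_riemannXiUpper']
    refine this.congr (Eventually.of_forall fun t x _ => ?_)
    change (iteratedDeriv k (G t) x).re = iteratedDeriv k (g t) x
    rw [hg, iteratedDeriv_re_ofReal (hdiff t)]

/-- **RH from the count WITH MULTIPLICITY at unboundedly many windows and convergence near the
axis.** `G_t` entire; for every `T > 0` an open `U ⊇ [0, T]` with `G_t → Ξ` locally uniformly on `U`;
for unboundedly many `T`, eventually a multiplicity datum of `G_t` on `(0, T]` of weight `≥ N(T)`.
Then the Riemann Hypothesis holds. -/
theorem riemannHypothesis_of_frequently_multCountGe_of_nhds {G : ℝ → ℂ → ℂ}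
    (hdiff : ∀ t, Differentiable ℂ (G t))
    (hC : ∃ᶠ T : ℝ in atTop, ∀ᶠ t : ℝ in atTop, ∃ (S : Finset ℝ) (m : ℝ → ℕ),
      (∀ x ∈ S, 0 < x ∧ x ≤ T) ∧ (∀ x ∈ S, 1 ≤ m x) ∧
        (∀ x ∈ S, ∀ i < m x, iteratedDeriv i (G t) (x : ℂ) = 0) ∧ zetaZeroCount T ≤ ∑ x ∈ S, m x)
    (hconv : ∀ T : ℝ, 0 < T → ∃ U : Set ℂ, IsOpen U ∧ (∀ x ∈ Icc (0 : ℝ) T, (x : ℂ) ∈ U) ∧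
      TendstoLocallyUniformlyOn G riemannXiUpper atTop U) :
    RiemannHypothesis := by
  have key : ∀ R : ℝ, ∀ z : ℂ, riemannXiUpper z = 0 → 0 < z.re → z.re ≤ R → z.im = 0 := by
    intro R z hz hz0 hzR
    obtain ⟨T, hTR, hCT⟩ := (hC.and_eventually (eventually_ge_atTop (max R 1))).exists
    have hT0 : 0 < T := lt_of_lt_of_le one_pos ((le_max_right _ _).trans hCT)
    obtain ⟨U, hUo, hseg, hloc⟩ := hconv T hT0
    exact im_eq_zero_of_multCountGe_of_nhds hdiff hUo hseg hTR hloc z hz hz0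
      (hzR.trans ((le_max_left _ _).trans hCT))
  refine (riemannHypothesis_iff_im_eq_zero_of_riemannXiUpper_eq_zero_holds :
    RiemannHypothesis ↔ _).mpr fun z hz => ?_
  rcases lt_trichotomy z.re 0 with hre | hre | hre
  · have hz' : riemannXiUpper (-z) = 0 := by rw [riemannXiUpper_neg]; exact hz
    have := key ((-z).re) (-z) hz' (by simp; linarith) le_rfl
    simpa using this
  · exact absurd hre (re_ne_zero_of_riemannXiUpper_eq_zero hz)
  · exact key z.re z hz hre le_rfl

/-- **Under RH, `Ξ` itself carries the multiplicity datum of weight `N(T)`**: the real zeros of `Ξ`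
in `(0, T]`, weighted by their analytic orders (derivatives below the order vanish), have total
weight `N(T)` — because under RH every zero of the box `0 < Re z ≤ T` is real
(`sum_analyticOrderNatAt_eq_zetaZeroCount`). No simplicity hypothesis. -/
theorem multCount_xi (hRH : RiemannHypothesis) (T : ℝ) :
    ∃ (S : Finset ℝ) (m : ℝ → ℕ), (∀ x ∈ S, 0 < x ∧ x ≤ T) ∧ (∀ x ∈ S, 1 ≤ m x) ∧
      (∀ x ∈ S, ∀ i < m x, iteratedDeriv i riemannXiUpper (x : ℂ) = 0) ∧
        zetaZeroCount T ≤ ∑ x ∈ S, m x := by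
  classical
  have hall : ∀ z : ℂ, riemannXiUpper z = 0 → z.im = 0 :=
    (riemannHypothesis_iff_im_eq_zero_of_riemannXiUpper_eq_zero_holds : RiemannHypothesis ↔ _).mp hRH
  set B := (xiZeros_finite T).toFinset with hB
  refine ⟨B.image Complex.re, fun x => analyticOrderNatAt riemannXiUpper (x : ℂ), ?_, ?_, ?_, ?_⟩
  · intro x hx
    obtain ⟨z, hz, rfl⟩ := Finset.mem_image.mp hx
    obtain ⟨_, h0, hT⟩ := (Set.Finite.mem_toFinset _).mp hz
    exact ⟨h0, hT⟩
  · intro x hx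
    obtain ⟨z, hz, rfl⟩ := Finset.mem_image.mp hx
    obtain ⟨hz0, _, _⟩ := (Set.Finite.mem_toFinset _).mp hz
    have hzre : ((z.re : ℝ) : ℂ) = z := Complex.ext (by simp) (by simp [hall z hz0])
    show 1 ≤ analyticOrderNatAt riemannXiUpper ((z.re : ℝ) : ℂ)
    rw [hzre]
    exact one_le_analyticOrderNatAt_of_zero hz0
  · intro x _ i hi
    have han := analyticAt_riemannXiUpper (x : ℂ)
    have hle : ((analyticOrderNatAt riemannXiUpper (x : ℂ) : ℕ) : ℕ∞) ≤
        analyticOrderAt riemannXiUpper (x : ℂ) := by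
      rw [Nat.cast_analyticOrderNatAt (analyticOrderAt_riemannXiUpper_ne_top _)]
    exact ((natCast_le_analyticOrderAt_iff_iteratedDeriv_eq_zero han).mp hle) i
      (by exact_mod_cast hi)
  · rw [← sum_analyticOrderNatAt_eq_zetaZeroCount T, ← hB, Finset.sum_image]
    · refine le_of_eq (Finset.sum_congr rfl fun z hz => ?_)
      obtain ⟨hz0, _, _⟩ := (Set.Finite.mem_toFinset _).mp hz
      have hzre : ((z.re : ℝ) : ℂ) = z := Complex.ext (by simp) (by simp [hall z hz0])
      show analyticOrderNatAt riemannXiUpper z = analyticOrderNatAt riemannXiUpper ((z.re : ℝ) : ℂ)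
      rw [hzre]
    · intro z hz w hw h
      obtain ⟨hz0, _, _⟩ := (Set.Finite.mem_toFinset _).mp hz
      obtain ⟨hw0, _, _⟩ := (Set.Finite.mem_toFinset _).mp hw
      exact Complex.ext h (by rw [hall z hz0, hall w hw0])

/-- **RH ⟺ the existence of a family satisfying ROUTE R-K with multiplicity.** The Riemann
Hypothesis holds if and only if there are entire functions `G_t` (`t → ∞`) such that (THIN,
neighbourhood form) for every `T > 0`, `G_t → Ξ` locally uniformly on some open `U ⊇ [0, T]`, and
(COUNT with multiplicity) for every `T > 0`, eventually in `t`, `G_t` has a multiplicity datum on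
`(0, T]` — finitely many real points `x` with weights `m x ≥ 1` and `G_t^{(i)}(x) = 0` for `i < m x` —
of total weight `≥ N(T)`. (⟸: this file; ⟹: the constant family `G_t := Ξ`, by `multCount_xi`.)
No realness, evenness, normalisation or simplicity clause is needed on either side. -/
theorem riemannHypothesis_iff_exists_multCount_nhds :
    RiemannHypothesis ↔ ∃ G : ℝ → ℂ → ℂ, (∀ t, Differentiable ℂ (G t)) ∧
      (∀ T : ℝ, 0 < T → ∀ᶠ t : ℝ in atTop, ∃ (S : Finset ℝ) (m : ℝ → ℕ),
        (∀ x ∈ S, 0 < x ∧ x ≤ T) ∧ (∀ x ∈ S, 1 ≤ m x) ∧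
          (∀ x ∈ S, ∀ i < m x, iteratedDeriv i (G t) (x : ℂ) = 0) ∧
            zetaZeroCount T ≤ ∑ x ∈ S, m x) ∧
      (∀ T : ℝ, 0 < T → ∃ U : Set ℂ, IsOpen U ∧ (∀ x ∈ Icc (0 : ℝ) T, (x : ℂ) ∈ U) ∧
        TendstoLocallyUniformlyOn G riemannXiUpper atTop U) := by
  constructor
  · intro hRH
    refine ⟨fun _ => riemannXiUpper, fun _ => differentiable_riemannXiUpper',
      fun T _ => Eventually.of_forall fun _ => multCount_xi hRH T, fun T _ => ?_⟩
    refine ⟨univ, isOpen_univ, fun _ _ => mem_univ _, ?_⟩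
    have : TendstoUniformlyOn (fun (_ : ℝ) => riemannXiUpper) riemannXiUpper atTop univ :=
      Metric.tendstoUniformlyOn_iff.mpr fun ε hε => Eventually.of_forall fun t z _ => by
        simpa using hε
    exact this.tendstoLocallyUniformlyOn
  · rintro ⟨G, hdiff, hC, hconv⟩
    exact riemannHypothesis_of_frequently_multCountGe_of_nhds hdiff
      (((eventually_gt_atTop (0 : ℝ)).mono fun T hT => hC T hT).frequently) hconv

/-- **The same with idea-3's thin rectangles (symmetric form, no evenness needed).** RH holds iff
there are entire `G_t` and one `δ > 0` with `G_t → Ξ` uniformly on `[-T, T] × [-δ, δ]` for every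
`T > 0` and, for every `T > 0`, eventually a multiplicity datum of `G_t` on `(0, T]` of weight
`≥ N(T)`. -/
theorem riemannHypothesis_iff_exists_multCount_thinRect :
    RiemannHypothesis ↔ ∃ G : ℝ → ℂ → ℂ, (∀ t, Differentiable ℂ (G t)) ∧
      (∀ T : ℝ, 0 < T → ∀ᶠ t : ℝ in atTop, ∃ (S : Finset ℝ) (m : ℝ → ℕ),
        (∀ x ∈ S, 0 < x ∧ x ≤ T) ∧ (∀ x ∈ S, 1 ≤ m x) ∧
          (∀ x ∈ S, ∀ i < m x, iteratedDeriv i (G t) (x : ℂ) = 0) ∧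
            zetaZeroCount T ≤ ∑ x ∈ S, m x) ∧
      (∃ δ : ℝ, 0 < δ ∧ ∀ T : ℝ, 0 < T →
        TendstoUniformlyOn G riemannXiUpper atTop (Icc (-T) T ×ℂ Icc (-δ) δ)) := by
  rw [riemannHypothesis_iff_exists_multCount_nhds]
  constructor
  · rintro ⟨G, hdiff, hC, hconv⟩
    -- under RH the constant family works; but we only know SOME family with the nbhd property:
    -- go through RH itself
    have hRH : RiemannHypothesis :=
      riemannHypothesis_of_frequently_multCountGe_of_nhds hdiff
        (((eventually_gt_atTop (0 : ℝ)).mono fun T hT => hC T hT).frequently) hconv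
    refine ⟨fun _ => riemannXiUpper, fun _ => differentiable_riemannXiUpper',
      fun T _ => Eventually.of_forall fun _ => multCount_xi hRH T, 1, one_pos, fun T _ => ?_⟩
    exact Metric.tendstoUniformlyOn_iff.mpr fun ε hε => Eventually.of_forall fun t z _ => by
      simpa using hε
  · rintro ⟨G, hdiff, hC, δ, hδ, hconv⟩
    refine ⟨G, hdiff, hC, fun T hT => ?_⟩
    refine ⟨Ioo (-(T + 1)) (T + 1) ×ℂ Ioo (-δ) δ, isOpen_Ioo.reProdIm isOpen_Ioo, fun x hx =>
      mem_reProdIm.mpr ⟨⟨by simp; linarith [hx.1], by simp; linarith [hx.2]⟩, by simp [hδ], by simp [hδ]⟩,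
      ((hconv (T + 1) (by linarith)).mono fun z hz => ?_).tendstoLocallyUniformlyOn⟩
    obtain ⟨⟨h1, h2⟩, h3, h4⟩ := mem_reProdIm.mp hz
    exact mem_reProdIm.mpr ⟨⟨h1.le, h2.le⟩, h3.le, h4.le⟩

/-! Axiom census (expected `propext`, `Classical.choice`, `Quot.sound`). -/
#print axioms riemannHypothesis_iff_exists_multCount_nhds
#print axioms riemannHypothesis_iff_exists_multCount_thinRect

end CountThin

end Summit.RiemannHypothesis.RiemannHypothesis.Theorems

end
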